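import Summits.SmoothPoincare4.SmoothPoincare4.Theorems.CylinderEntropySliceIsolationStubSeparationPersistsAux1
import HarnessLib

/-!
# End-separation persists along a cylinder flow, part 2: the differential of the tube chart is invertible; the inverse function theorem

Part of the proof of the stub `stub_separationPersists` (END-SEPARATION PERSISTS ALONG A CYLINDER
FLOW) of line `conformal-kernel-domination` (closing chain γ) of the crux `CylinderEntropy.SliceIsolation`
(stmt-SmoothPoincare4-7632); see `CylinderEntropySliceIsolationStubSeparationPersists.lean` for the
overall argument. Everything here is proved (no named facts, no definitions: the tube chart is passed
as a function `Ψ` with the hypothesis `hΨ` spelling it out, instantiated by `rfl`).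

* `fderiv_tubeChart_apply`, `fderiv_tubeChart_injective` — the differential of the augmented tube
  chart of part 1 at the centre is `(β, r, ρ) ↦ D(ι ∘ φ⁻¹) β + r ν(x₀) + ρ n(x₀)`, injective since
  `TΣ ⊥ ν ⊥ n`; by the dimension count `finrank_prod_eq_six` it is onto `ℝ⁶`, whence
  `abs_inner_nu_eq_one_of_normal`: a unit vector orthogonal to `TΣ` and to the radial normal is `± ν`;
* `map_tubeChart_nhds_eq`, `exists_ball_subset_pushoff` — by the inverse function theorem the tube
  chart maps neighbourhoods of the centre onto neighbourhoods of `ι x₀`, so every point of `N` close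
  to `ι x₀` is a normalised push-off `nrm(ι x + r ν x)` with `|r|` small (a point of `N` has scaling
  parameter `ρ = 0`).

## References

* M. W. Hirsch, *Differential Topology*, GTM 33 (1976), Ch. 4 §5 (tubular neighbourhoods), Ch. 8
  Thm. 1.3 (isotopy extension). [HirschDT1976]
* A. Hatcher, *Algebraic Topology*, CUP (2002), Prop. 3.46 (Jordan–Brouwer separation via Alexander
  duality). [HatcherAT2002]
-/

set_option linter.dupNamespace false

noncomputable section

open MeasureTheory Set Function Filter Module Asymptotics Metric
open scoped Manifold ContDiff ENNReal Topology RealInnerProductSpace NNReal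

namespace Summit.SmoothPoincare4.SmoothPoincare4.Theorems.CylinderEntropySliceIsolation

open Summit.SmoothPoincare4.SmoothPoincare4.Theorems.CylinderRungTwo.KillingFlux
open Literature.Geometry.Riemannian
open Literature.Geometry.Lorentzian Literature.Geometry.Lorentzian.PseudoRiemannianMetric
open Literature.Geometry.Riemannian.SphericalCylinderEntropy (truncL truncL_apply lipschitz_truncL)
open Literature.Geometry.Manifold.CylinderSlice (axis castSucc_ne_five padL padL_apply_castSucc
  padL_apply_last)

section TubeChart

variable {M : Type} [TopologicalSpace M] [ChartedSpace (EuclideanSpace ℝ (Fin 4)) M]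
  [IsManifold (𝓡 4) ∞ M]

variable {ι ν : M → EuclideanSpace ℝ (Fin 6)} {Ψ : EuclideanSpace ℝ (Fin 4) × ℝ × ℝ → EuclideanSpace ℝ (Fin 6)}

/-- **The differential of the tube chart at the centre**:
`DΨ(β, r, ρ) = DΨ(β, 0, 0) + r ν(x₀) + ρ n(x₀)` (and `DΨ(β, 0, 0) = D(ι ∘ φ⁻¹) β`,
`fderiv_tubeChart_inl`). [folklore] -/
theorem fderiv_tubeChart_apply (hι : Manifold.IsSmoothEmbedding (𝓡 4) (𝓡 6) ∞ ι)
    (hιN : ∀ x, ∑ i : Fin 5, ι x (Fin.castSucc i) ^ 2 = 1) (hνs : ContMDiff (𝓡 4) (𝓡 6) ∞ ν)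
    (hνt : ∀ x, ∑ i : Fin 5, ν x (Fin.castSucc i) * ι x (Fin.castSucc i) = 0) (x₀ : M)
    (hΨ : Ψ = fun p : EuclideanSpace ℝ (Fin 4) × ℝ × ℝ =>
      (fun z : EuclideanSpace ℝ (Fin 6) => (‖truncL z‖⁻¹ : ℝ) • (z - z (5 : Fin 6) •
        (axis : EuclideanSpace ℝ (Fin 6))) + z (5 : Fin 6) • (axis : EuclideanSpace ℝ (Fin 6)))
        (ι ((extChartAt (𝓡 4) x₀).symm p.1) + p.2.1 • ν ((extChartAt (𝓡 4) x₀).symm p.1)) +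
      p.2.2 • ((fun z : EuclideanSpace ℝ (Fin 6) => (‖truncL z‖⁻¹ : ℝ) • (z - z (5 : Fin 6) •
        (axis : EuclideanSpace ℝ (Fin 6))) + z (5 : Fin 6) • (axis : EuclideanSpace ℝ (Fin 6)))
        (ι ((extChartAt (𝓡 4) x₀).symm p.1) + p.2.1 • ν ((extChartAt (𝓡 4) x₀).symm p.1)) -
        ((fun z : EuclideanSpace ℝ (Fin 6) => (‖truncL z‖⁻¹ : ℝ) • (z - z (5 : Fin 6) •
        (axis : EuclideanSpace ℝ (Fin 6))) + z (5 : Fin 6) • (axis : EuclideanSpace ℝ (Fin 6)))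
        (ι ((extChartAt (𝓡 4) x₀).symm p.1) + p.2.1 • ν ((extChartAt (𝓡 4) x₀).symm p.1))) (5 : Fin 6) •
          (axis : EuclideanSpace ℝ (Fin 6))))
    (β : EuclideanSpace ℝ (Fin 4)) (r ρ : ℝ) :
    fderiv ℝ Ψ (extChartAt (𝓡 4) x₀ x₀, 0, 0) (β, r, ρ) =
      fderiv ℝ Ψ (extChartAt (𝓡 4) x₀ x₀, 0, 0) (β, 0, 0) + r • ν x₀ +
        ρ • (ι x₀ - ι x₀ (5 : Fin 6) • (axis : EuclideanSpace ℝ (Fin 6))) := by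
  have hsplit : ((β, r, ρ) : EuclideanSpace ℝ (Fin 4) × ℝ × ℝ) =
      (β, (0 : ℝ), (0 : ℝ)) + r • ((0 : EuclideanSpace ℝ (Fin 4)), (1 : ℝ), (0 : ℝ)) +
        ρ • ((0 : EuclideanSpace ℝ (Fin 4)), (0 : ℝ), (1 : ℝ)) := by
    ext <;> simp
  conv_lhs => rw [hsplit, map_add, map_add, map_smul, map_smul, fderiv_tubeChart_r hι hιN hνs hνt x₀ hΨ,
    fderiv_tubeChart_rho hι hιN hνs hνt x₀ hΨ]

/-- **The differential of the tube chart at the centre is injective** (`TΣ ⊥ ν ⊥ n`, all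
non-degenerate). [folklore] -/
theorem fderiv_tubeChart_injective (hι : Manifold.IsSmoothEmbedding (𝓡 4) (𝓡 6) ∞ ι)
    (hιN : ∀ x, ∑ i : Fin 5, ι x (Fin.castSucc i) ^ 2 = 1) (hνs : ContMDiff (𝓡 4) (𝓡 6) ∞ ν)
    (hνn : (euclideanMetric (EuclideanSpace ℝ (Fin 6))).IsUnitNormal (𝓡 4) ι ν 1)
    (hνt : ∀ x, ∑ i : Fin 5, ν x (Fin.castSucc i) * ι x (Fin.castSucc i) = 0) (x₀ : M)
    (hΨ : Ψ = fun p : EuclideanSpace ℝ (Fin 4) × ℝ × ℝ =>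
      (fun z : EuclideanSpace ℝ (Fin 6) => (‖truncL z‖⁻¹ : ℝ) • (z - z (5 : Fin 6) •
        (axis : EuclideanSpace ℝ (Fin 6))) + z (5 : Fin 6) • (axis : EuclideanSpace ℝ (Fin 6)))
        (ι ((extChartAt (𝓡 4) x₀).symm p.1) + p.2.1 • ν ((extChartAt (𝓡 4) x₀).symm p.1)) +
      p.2.2 • ((fun z : EuclideanSpace ℝ (Fin 6) => (‖truncL z‖⁻¹ : ℝ) • (z - z (5 : Fin 6) •
        (axis : EuclideanSpace ℝ (Fin 6))) + z (5 : Fin 6) • (axis : EuclideanSpace ℝ (Fin 6)))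
        (ι ((extChartAt (𝓡 4) x₀).symm p.1) + p.2.1 • ν ((extChartAt (𝓡 4) x₀).symm p.1)) -
        ((fun z : EuclideanSpace ℝ (Fin 6) => (‖truncL z‖⁻¹ : ℝ) • (z - z (5 : Fin 6) •
        (axis : EuclideanSpace ℝ (Fin 6))) + z (5 : Fin 6) • (axis : EuclideanSpace ℝ (Fin 6)))
        (ι ((extChartAt (𝓡 4) x₀).symm p.1) + p.2.1 • ν ((extChartAt (𝓡 4) x₀).symm p.1))) (5 : Fin 6) •
          (axis : EuclideanSpace ℝ (Fin 6)))) :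
    Injective (fderiv ℝ Ψ (extChartAt (𝓡 4) x₀ x₀, 0, 0)) := by
  letI : NormedAddCommGroup (TangentSpace (𝓡 6) (ι x₀)) := inferInstanceAs (NormedAddCommGroup (EuclideanSpace ℝ (Fin 6)))
  letI : InnerProductSpace ℝ (TangentSpace (𝓡 6) (ι x₀)) := inferInstanceAs (InnerProductSpace ℝ (EuclideanSpace ℝ (Fin 6)))
  refine (injective_iff_map_eq_zero _).2 ?_
  rintro ⟨β, r, ρ⟩ h
  have hx₀ : (extChartAt (𝓡 4) x₀).symm (extChartAt (𝓡 4) x₀ x₀) = x₀ := extChartAt_to_inv x₀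
  set A : EuclideanSpace ℝ (Fin 4) →L[ℝ] EuclideanSpace ℝ (Fin 6) :=
    (((mfderiv (𝓡 4) (𝓡 6) ι ((extChartAt (𝓡 4) x₀).symm (extChartAt (𝓡 4) x₀ x₀))).comp
        (mfderivWithin 𝓘(ℝ, EuclideanSpace ℝ (Fin 4)) (𝓡 4) (extChartAt (𝓡 4) x₀).symm (range (𝓡 4))
          (extChartAt (𝓡 4) x₀ x₀))) : EuclideanSpace ℝ (Fin 4) →L[ℝ] EuclideanSpace ℝ (Fin 6)) with hA
  have hLA : fderiv ℝ Ψ (extChartAt (𝓡 4) x₀ x₀, 0, 0) (β, 0, 0) = A β :=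
    fderiv_tubeChart_inl hι hιN hνs hνt x₀ hΨ β
  rw [fderiv_tubeChart_apply hι hιN hνs hνt x₀ hΨ, hLA] at h
  -- the three mutually orthogonal pieces
  have hνx : ν ((extChartAt (𝓡 4) x₀).symm (extChartAt (𝓡 4) x₀ x₀)) = ν x₀ := by rw [hx₀]
  have hιx : ι ((extChartAt (𝓡 4) x₀).symm (extChartAt (𝓡 4) x₀ x₀)) = ι x₀ := by rw [hx₀]
  have hAν : ⟪ν x₀, A β⟫ = 0 := by
    rw [← hνx]
    exact inner_nu_mfderiv hνn ((extChartAt (𝓡 4) x₀).symm (extChartAt (𝓡 4) x₀ x₀))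
      ((mfderivWithin 𝓘(ℝ, EuclideanSpace ℝ (Fin 4)) (𝓡 4) (extChartAt (𝓡 4) x₀).symm (range (𝓡 4))
        (extChartAt (𝓡 4) x₀ x₀)) β)
  have hAn : ⟪ι x₀ - ι x₀ (5 : Fin 6) • (axis : EuclideanSpace ℝ (Fin 6)), A β⟫ = 0 := by
    rw [← hιx]
    exact inner_nrad_mfderiv hι hιN ((extChartAt (𝓡 4) x₀).symm (extChartAt (𝓡 4) x₀ x₀))
      ((mfderivWithin 𝓘(ℝ, EuclideanSpace ℝ (Fin 4)) (𝓡 4) (extChartAt (𝓡 4) x₀).symm (range (𝓡 4))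
        (extChartAt (𝓡 4) x₀ x₀)) β)
  have hνν : ⟪ν x₀, ν x₀⟫ = 1 := by rw [real_inner_self_eq_norm_sq, norm_nu hνn]; norm_num
  have hnn : ⟪ι x₀ - ι x₀ (5 : Fin 6) • (axis : EuclideanSpace ℝ (Fin 6)),
      ι x₀ - ι x₀ (5 : Fin 6) • (axis : EuclideanSpace ℝ (Fin 6))⟫ = 1 := by
    rw [real_inner_self_eq_norm_sq, norm_nrad hιN]; norm_num
  have hνn' : ⟪ν x₀, ι x₀ - ι x₀ (5 : Fin 6) • (axis : EuclideanSpace ℝ (Fin 6))⟫ = 0 := inner_nu_nrad hνt x₀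
  have hr : r = 0 := by
    have := congrArg (fun w => ⟪ν x₀, w⟫) h
    simp only [inner_add_right, inner_smul_right, hAν, hνν, hνn', inner_zero_right] at this
    linarith
  have hρ : ρ = 0 := by
    have := congrArg (fun w => ⟪ι x₀ - ι x₀ (5 : Fin 6) • (axis : EuclideanSpace ℝ (Fin 6)), w⟫) h
    rw [real_inner_comm] at hνn'
    simp only [inner_add_right, inner_smul_right, hAn, hnn, hνn', inner_zero_right] at this
    linarith
  rw [hr, hρ, zero_smul, zero_smul, add_zero, add_zero] at h
  have hβ : β = 0 := by
    have hinj := chartDeriv_injective hι x₀ (mem_extChartAt_target x₀)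
    exact hinj (h.trans (map_zero A).symm)
  simp [hβ, hr, hρ]

/-- `dim (ℝ⁴ × ℝ × ℝ) = dim ℝ⁶`. [folklore] -/
theorem finrank_prod_eq_six :
    Module.finrank ℝ (EuclideanSpace ℝ (Fin 4) × ℝ × ℝ) = Module.finrank ℝ (EuclideanSpace ℝ (Fin 6)) := by
  simp [Module.finrank_prod]

/-- **The unit normal is determined up to sign by the tangent space and the radial normal**: a
unit vector of `ℝ⁶` orthogonal to `D(ι ∘ φ⁻¹)(φ x₀)(ℝ⁴) = T_{ι x₀}Σ` and to the radial normal
`n(x₀)` is `± ν(x₀)` (the differential of the tube chart is onto `ℝ⁶`). [folklore] -/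
theorem abs_inner_nu_eq_one_of_normal (hι : Manifold.IsSmoothEmbedding (𝓡 4) (𝓡 6) ∞ ι)
    (hιN : ∀ x, ∑ i : Fin 5, ι x (Fin.castSucc i) ^ 2 = 1) (hνs : ContMDiff (𝓡 4) (𝓡 6) ∞ ν)
    (hνn : (euclideanMetric (EuclideanSpace ℝ (Fin 6))).IsUnitNormal (𝓡 4) ι ν 1)
    (hνt : ∀ x, ∑ i : Fin 5, ν x (Fin.castSucc i) * ι x (Fin.castSucc i) = 0) (x₀ : M)
    (hΨ : Ψ = fun p : EuclideanSpace ℝ (Fin 4) × ℝ × ℝ =>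
      (fun z : EuclideanSpace ℝ (Fin 6) => (‖truncL z‖⁻¹ : ℝ) • (z - z (5 : Fin 6) •
        (axis : EuclideanSpace ℝ (Fin 6))) + z (5 : Fin 6) • (axis : EuclideanSpace ℝ (Fin 6)))
        (ι ((extChartAt (𝓡 4) x₀).symm p.1) + p.2.1 • ν ((extChartAt (𝓡 4) x₀).symm p.1)) +
      p.2.2 • ((fun z : EuclideanSpace ℝ (Fin 6) => (‖truncL z‖⁻¹ : ℝ) • (z - z (5 : Fin 6) •
        (axis : EuclideanSpace ℝ (Fin 6))) + z (5 : Fin 6) • (axis : EuclideanSpace ℝ (Fin 6)))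
        (ι ((extChartAt (𝓡 4) x₀).symm p.1) + p.2.1 • ν ((extChartAt (𝓡 4) x₀).symm p.1)) -
        ((fun z : EuclideanSpace ℝ (Fin 6) => (‖truncL z‖⁻¹ : ℝ) • (z - z (5 : Fin 6) •
        (axis : EuclideanSpace ℝ (Fin 6))) + z (5 : Fin 6) • (axis : EuclideanSpace ℝ (Fin 6)))
        (ι ((extChartAt (𝓡 4) x₀).symm p.1) + p.2.1 • ν ((extChartAt (𝓡 4) x₀).symm p.1))) (5 : Fin 6) •
          (axis : EuclideanSpace ℝ (Fin 6))))
    {κ : EuclideanSpace ℝ (Fin 6)}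
    (hκA : ∀ β : EuclideanSpace ℝ (Fin 4),
      ⟪κ, fderiv ℝ Ψ (extChartAt (𝓡 4) x₀ x₀, 0, 0) (β, 0, 0)⟫ = 0)
    (hκn : ⟪κ, ι x₀ - ι x₀ (5 : Fin 6) • (axis : EuclideanSpace ℝ (Fin 6))⟫ = 0) (hκ1 : ‖κ‖ = 1) :
    |⟪κ, ν x₀⟫| = 1 := by
  have hsurj : Surjective (fderiv ℝ Ψ (extChartAt (𝓡 4) x₀ x₀, 0, 0)).toLinearMap :=
    (LinearMap.injective_iff_surjective_of_finrank_eq_finrank finrank_prod_eq_six).1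
      (fderiv_tubeChart_injective hι hιN hνs hνn hνt x₀ hΨ)
  obtain ⟨⟨β, r, ρ⟩, hp⟩ := hsurj κ
  rw [ContinuousLinearMap.coe_coe, fderiv_tubeChart_apply hι hιN hνs hνt x₀ hΨ] at hp
  have hνν : ⟪ν x₀, ν x₀⟫ = 1 := by rw [real_inner_self_eq_norm_sq, norm_nu hνn]; norm_num
  have hnn : ⟪ι x₀ - ι x₀ (5 : Fin 6) • (axis : EuclideanSpace ℝ (Fin 6)),
      ι x₀ - ι x₀ (5 : Fin 6) • (axis : EuclideanSpace ℝ (Fin 6))⟫ = 1 := by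
    rw [real_inner_self_eq_norm_sq, norm_nrad hιN]; norm_num
  have hνn' : ⟪ν x₀, ι x₀ - ι x₀ (5 : Fin 6) • (axis : EuclideanSpace ℝ (Fin 6))⟫ = 0 := inner_nu_nrad hνt x₀
  have hx₀ : (extChartAt (𝓡 4) x₀).symm (extChartAt (𝓡 4) x₀ x₀) = x₀ := extChartAt_to_inv x₀
  have hνx : ν ((extChartAt (𝓡 4) x₀).symm (extChartAt (𝓡 4) x₀ x₀)) = ν x₀ := by rw [hx₀]
  have hιx : ι ((extChartAt (𝓡 4) x₀).symm (extChartAt (𝓡 4) x₀ x₀)) = ι x₀ := by rw [hx₀]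
  set A : EuclideanSpace ℝ (Fin 4) →L[ℝ] EuclideanSpace ℝ (Fin 6) :=
    (((mfderiv (𝓡 4) (𝓡 6) ι ((extChartAt (𝓡 4) x₀).symm (extChartAt (𝓡 4) x₀ x₀))).comp
        (mfderivWithin 𝓘(ℝ, EuclideanSpace ℝ (Fin 4)) (𝓡 4) (extChartAt (𝓡 4) x₀).symm (range (𝓡 4))
          (extChartAt (𝓡 4) x₀ x₀))) : EuclideanSpace ℝ (Fin 4) →L[ℝ] EuclideanSpace ℝ (Fin 6)) with hA
  have hLA : fderiv ℝ Ψ (extChartAt (𝓡 4) x₀ x₀, 0, 0) (β, 0, 0) = A β :=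
    fderiv_tubeChart_inl hι hιN hνs hνt x₀ hΨ β
  have hAν : ⟪ν x₀, A β⟫ = 0 := by
    rw [← hνx]
    exact inner_nu_mfderiv hνn ((extChartAt (𝓡 4) x₀).symm (extChartAt (𝓡 4) x₀ x₀))
      ((mfderivWithin 𝓘(ℝ, EuclideanSpace ℝ (Fin 4)) (𝓡 4) (extChartAt (𝓡 4) x₀).symm (range (𝓡 4))
        (extChartAt (𝓡 4) x₀ x₀)) β)
  have hAn : ⟪ι x₀ - ι x₀ (5 : Fin 6) • (axis : EuclideanSpace ℝ (Fin 6)), A β⟫ = 0 := by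
    rw [← hιx]
    exact inner_nrad_mfderiv hι hιN ((extChartAt (𝓡 4) x₀).symm (extChartAt (𝓡 4) x₀ x₀))
      ((mfderivWithin 𝓘(ℝ, EuclideanSpace ℝ (Fin 4)) (𝓡 4) (extChartAt (𝓡 4) x₀).symm (range (𝓡 4))
        (extChartAt (𝓡 4) x₀ x₀)) β)
  rw [hLA] at hp
  -- `A β = 0` from `⟪κ, A β⟫ = 0`
  have hκAβ : ⟪κ, A β⟫ = 0 := by rw [← hLA]; exact hκA β
  have hAβ : A β = 0 := by
    rw [← hp, inner_add_left, inner_add_left, inner_smul_left, inner_smul_left, hAν, hAn] at hκAβ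
    simp only [RCLike.conj_to_real, mul_zero, add_zero] at hκAβ
    exact inner_self_eq_zero.1 hκAβ
  -- `ρ = 0` from `⟪κ, n⟫ = 0`
  have hρ : ρ = 0 := by
    rw [← hp, hAβ, zero_add, inner_add_left, inner_smul_left, inner_smul_left, hνn', hnn] at hκn
    simpa using hκn
  rw [hAβ, hρ, zero_add, zero_smul, add_zero] at hp
  rw [← hp, inner_smul_left, hνν, RCLike.conj_to_real, mul_one]
  have := congrArg norm hp
  rw [norm_smul, norm_nu hνn, mul_one, hκ1, Real.norm_eq_abs] at this
  exact this

/-! ## §3 The inverse function theorem for the tube chart -/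

/-- **The tube chart maps neighbourhoods of the centre onto neighbourhoods of `ι x₀`**
(inverse function theorem: its differential at the centre is an isomorphism `ℝ⁴ × ℝ × ℝ ≅ ℝ⁶`).
[folklore] -/
theorem map_tubeChart_nhds_eq (hι : Manifold.IsSmoothEmbedding (𝓡 4) (𝓡 6) ∞ ι)
    (hιN : ∀ x, ∑ i : Fin 5, ι x (Fin.castSucc i) ^ 2 = 1) (hνs : ContMDiff (𝓡 4) (𝓡 6) ∞ ν)
    (hνn : (euclideanMetric (EuclideanSpace ℝ (Fin 6))).IsUnitNormal (𝓡 4) ι ν 1)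
    (hνt : ∀ x, ∑ i : Fin 5, ν x (Fin.castSucc i) * ι x (Fin.castSucc i) = 0) (x₀ : M)
    (hΨ : Ψ = fun p : EuclideanSpace ℝ (Fin 4) × ℝ × ℝ =>
      (fun z : EuclideanSpace ℝ (Fin 6) => (‖truncL z‖⁻¹ : ℝ) • (z - z (5 : Fin 6) •
        (axis : EuclideanSpace ℝ (Fin 6))) + z (5 : Fin 6) • (axis : EuclideanSpace ℝ (Fin 6)))
        (ι ((extChartAt (𝓡 4) x₀).symm p.1) + p.2.1 • ν ((extChartAt (𝓡 4) x₀).symm p.1)) +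
      p.2.2 • ((fun z : EuclideanSpace ℝ (Fin 6) => (‖truncL z‖⁻¹ : ℝ) • (z - z (5 : Fin 6) •
        (axis : EuclideanSpace ℝ (Fin 6))) + z (5 : Fin 6) • (axis : EuclideanSpace ℝ (Fin 6)))
        (ι ((extChartAt (𝓡 4) x₀).symm p.1) + p.2.1 • ν ((extChartAt (𝓡 4) x₀).symm p.1)) -
        ((fun z : EuclideanSpace ℝ (Fin 6) => (‖truncL z‖⁻¹ : ℝ) • (z - z (5 : Fin 6) •
        (axis : EuclideanSpace ℝ (Fin 6))) + z (5 : Fin 6) • (axis : EuclideanSpace ℝ (Fin 6)))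
        (ι ((extChartAt (𝓡 4) x₀).symm p.1) + p.2.1 • ν ((extChartAt (𝓡 4) x₀).symm p.1))) (5 : Fin 6) •
          (axis : EuclideanSpace ℝ (Fin 6)))) :
    map Ψ (𝓝 (extChartAt (𝓡 4) x₀ x₀, 0, 0)) = 𝓝 (ι x₀) := by
  set L := fderiv ℝ Ψ (extChartAt (𝓡 4) x₀ x₀, 0, 0) with hL
  have hinj : Injective L.toLinearMap := fderiv_tubeChart_injective hι hιN hνs hνn hνt x₀ hΨ
  set Le : (EuclideanSpace ℝ (Fin 4) × ℝ × ℝ) ≃L[ℝ] EuclideanSpace ℝ (Fin 6) :=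
    (LinearMap.linearEquivOfInjective L.toLinearMap hinj finrank_prod_eq_six).toContinuousLinearEquiv with hLe
  have hcoe : (Le : (EuclideanSpace ℝ (Fin 4) × ℝ × ℝ) →L[ℝ] EuclideanSpace ℝ (Fin 6)) = L := by
    exact ContinuousLinearMap.ext fun v => rfl
  have hstrict : HasStrictFDerivAt Ψ
      (Le : (EuclideanSpace ℝ (Fin 4) × ℝ × ℝ) →L[ℝ] EuclideanSpace ℝ (Fin 6)) (extChartAt (𝓡 4) x₀ x₀, 0, 0) :=
    (hasStrictFDerivAt_tubeChart hι hιN hνs hνt x₀ hΨ).congr_fderiv hcoe.symm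
  have h0 : Ψ (extChartAt (𝓡 4) x₀ x₀, 0, 0) = ι x₀ := by
    rw [tubeChart_zero_left hιN x₀ hΨ, extChartAt_to_inv, zero_smul, add_zero]
  rw [← h0]
  exact hstrict.map_nhds_eq_of_equiv

/-- **Points of `N` near `ι x₀` are normalised push-offs**: for every `ε > 0` there is `δ > 0`
such that every `z ∈ N` with `‖z - ι x₀‖ < δ` is `nrm(ι x + r ν x)` for some `x ∈ M` and
`|r| < ε` (local surjectivity of the tube chart; a point of `N` has scaling parameter `ρ = 0`).
[folklore] -/
theorem exists_ball_subset_pushoff (hι : Manifold.IsSmoothEmbedding (𝓡 4) (𝓡 6) ∞ ι)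
    (hιN : ∀ x, ∑ i : Fin 5, ι x (Fin.castSucc i) ^ 2 = 1) (hνs : ContMDiff (𝓡 4) (𝓡 6) ∞ ν)
    (hνn : (euclideanMetric (EuclideanSpace ℝ (Fin 6))).IsUnitNormal (𝓡 4) ι ν 1)
    (hνt : ∀ x, ∑ i : Fin 5, ν x (Fin.castSucc i) * ι x (Fin.castSucc i) = 0) (x₀ : M)
    (hΨ : Ψ = fun p : EuclideanSpace ℝ (Fin 4) × ℝ × ℝ =>
      (fun z : EuclideanSpace ℝ (Fin 6) => (‖truncL z‖⁻¹ : ℝ) • (z - z (5 : Fin 6) •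
        (axis : EuclideanSpace ℝ (Fin 6))) + z (5 : Fin 6) • (axis : EuclideanSpace ℝ (Fin 6)))
        (ι ((extChartAt (𝓡 4) x₀).symm p.1) + p.2.1 • ν ((extChartAt (𝓡 4) x₀).symm p.1)) +
      p.2.2 • ((fun z : EuclideanSpace ℝ (Fin 6) => (‖truncL z‖⁻¹ : ℝ) • (z - z (5 : Fin 6) •
        (axis : EuclideanSpace ℝ (Fin 6))) + z (5 : Fin 6) • (axis : EuclideanSpace ℝ (Fin 6)))
        (ι ((extChartAt (𝓡 4) x₀).symm p.1) + p.2.1 • ν ((extChartAt (𝓡 4) x₀).symm p.1)) -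
        ((fun z : EuclideanSpace ℝ (Fin 6) => (‖truncL z‖⁻¹ : ℝ) • (z - z (5 : Fin 6) •
        (axis : EuclideanSpace ℝ (Fin 6))) + z (5 : Fin 6) • (axis : EuclideanSpace ℝ (Fin 6)))
        (ι ((extChartAt (𝓡 4) x₀).symm p.1) + p.2.1 • ν ((extChartAt (𝓡 4) x₀).symm p.1))) (5 : Fin 6) •
          (axis : EuclideanSpace ℝ (Fin 6))))
    {ε : ℝ} (hε : 0 < ε) :
    ∃ δ : ℝ, 0 < δ ∧ ∀ z : EuclideanSpace ℝ (Fin 6), ∑ i : Fin 5, z (Fin.castSucc i) ^ 2 = 1 →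
      ‖z - ι x₀‖ < δ → ∃ x : M, ∃ r : ℝ, |r| < ε ∧
        z = (fun z : EuclideanSpace ℝ (Fin 6) => (‖truncL z‖⁻¹ : ℝ) • (z - z (5 : Fin 6) •
          (axis : EuclideanSpace ℝ (Fin 6))) + z (5 : Fin 6) • (axis : EuclideanSpace ℝ (Fin 6))) (ι x + r • ν x) := by
  set U : Set (EuclideanSpace ℝ (Fin 4) × ℝ × ℝ) :=
    (Prod.fst ⁻¹' (extChartAt (𝓡 4) x₀).target) ∩ {p | |p.2.1| < ε} ∩ {p | |p.2.2| < 1} with hU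
  have hUo : IsOpen U := by
    refine (((isOpen_extChartAt_target x₀).preimage continuous_fst).inter
      (isOpen_lt ?_ continuous_const)).inter (isOpen_lt ?_ continuous_const)
    · exact continuous_abs.comp (continuous_fst.comp continuous_snd)
    · exact continuous_abs.comp (continuous_snd.comp continuous_snd)
  have hUmem : U ∈ 𝓝 ((extChartAt (𝓡 4) x₀ x₀, 0, 0) : EuclideanSpace ℝ (Fin 4) × ℝ × ℝ) :=
    hUo.mem_nhds ⟨⟨mem_extChartAt_target x₀, by simpa using hε⟩, by simp⟩
  have himg : Ψ '' U ∈ 𝓝 (ι x₀) := by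
    rw [← map_tubeChart_nhds_eq hι hιN hνs hνn hνt x₀ hΨ]
    exact image_mem_map hUmem
  obtain ⟨δ, hδ, hball⟩ := Metric.mem_nhds_iff.1 himg
  refine ⟨δ, hδ, fun z hz hzd => ?_⟩
  obtain ⟨⟨b, r, ρ⟩, ⟨⟨hb, hr⟩, hρ⟩, hzq⟩ := hball (mem_ball_iff_norm.2 hzd)
  refine ⟨(extChartAt (𝓡 4) x₀).symm b, r, hr, ?_⟩
  -- the point of `N` has `ρ = 0`
  have hw : ∑ i : Fin 5, ((fun z : EuclideanSpace ℝ (Fin 6) => (‖truncL z‖⁻¹ : ℝ) • (z - z (5 : Fin 6) •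
      (axis : EuclideanSpace ℝ (Fin 6))) + z (5 : Fin 6) • (axis : EuclideanSpace ℝ (Fin 6)))
      (ι ((extChartAt (𝓡 4) x₀).symm b) + r • ν ((extChartAt (𝓡 4) x₀).symm b))) (Fin.castSucc i) ^ 2 = 1 :=
    sum_sq_nrm (norm_nrm_sub_le (hιN _) (hνt _) r).1
  have hρ0 : ρ = 0 := by
    have hzN := hz
    rw [← hzq, hΨ] at hzN
    exact (radScale_mem_iff hw hρ).1 hzN
  rw [← hzq, hρ0, tubeChart_zero ι ν x₀ hΨ]

end TubeChart

/-- Marker of this part (registered sub-goal `helper_sepPersistsFinrank` of stmt-SmoothPoincare4-7632): `dim(ℝ⁴ × ℝ × ℝ) = dim ℝ⁶` (`finrank_prod_eq_six`, the dimension count making the injective differential of the tube chart an isomorphism). [folklore] -/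
theorem helper_sepPersistsFinrank :
    Module.finrank ℝ (EuclideanSpace ℝ (Fin 4) × ℝ × ℝ) = Module.finrank ℝ (EuclideanSpace ℝ (Fin 6)) :=
  finrank_prod_eq_six

end Summit.SmoothPoincare4.SmoothPoincare4.Theorems.CylinderEntropySliceIsolation
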